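import Literature.NumberTheory.EllipticCurves.SerreOpenImageSupersingularValuationProofs
import Literature.NumberTheory.EllipticCurves.SerreOpenImageOrdinaryInertiaProofs
import Literature.NumberTheory.EllipticCurves.KuriharaNumberKimShaLengthLocalTorsionTrivial
import Literature.NumberTheory.EllipticCurves.VariableChangePoints
import Literature.NumberTheory.EllipticCurves.QuadraticTwist
import Mathlib.NumberTheory.Padics.PadicNumbers
import Mathlib.FieldTheory.IsAlgClosed.AlgebraicClosure
import Mathlib.Analysis.Normed.Group.Ultra
import HarnessLib

/-!
# `W(ℚ_p)[p] = 0` for every model `W` of a quadratic twist of a curve with good SUPERSINGULAR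
# reduction at an odd prime `p` — in particular for the ADDITIVE partners `W = V ⊗ χ_{p*}` (Kodaira
# type `I₀*`, potentially good supersingular over `ℚ_p(√p*)`) of the good supersingular `a_p = 0` curves

`Proofs`-style file (THEOREMS ONLY: no definition, no named fact, no instance; net debt 0), topic
`NumberTheory/EllipticCurves`; the additive-twist companion of `LocalTorsionGoodReductionProofs`
(`E(ℚ_p)[p] = 0` at a good non-anomalous `p`) and `LocalTorsionMultiplicativeProofs`.

STATEMENT (`natCard_localPTorsion_eq_one_of_twist_of_supersingular`). Let `V/ℚ` be a globally
minimal elliptic curve with good reduction at an odd prime `p` and `p ∣ a_p(V)` (supersingular; for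
`p ≥ 5` this is `a_p(V) = 0`), and let `W/ℚ` be ANY Weierstrass model with `C • W^{(d)} = V` for some
`d ∈ ℚˣ` and some change of variables `C` over `ℚ` (so `W` is a model of the quadratic twist
`V^{(d)}`; for `d = p* = ±p` these are exactly the additive partners of the cell `bsd-potss`'s K8
route). Then `W(ℚ_p)` has no point of order `p`:
`Nat.card {Q : W(ℚ_p) // p • Q = O} = 1` — the `(t0)` binder `#E(ℚ_p)[p] = 1` of the tree's typed
statements of C.-H. Kim's structure theorems (`Kim2026.…`, `KuriharaNumberKim…`) for `E := W`.

This is the case "`E` additive at `p`, `p ≥ 5`, `e = 2`" of C.-H. Kim, Amer. J. Math. 148 (2026) =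
arXiv:2203.12159, Prop. 3.2 (PDF p. 15: for an additive `E/ℚ_p`, `E(ℚ_p)[p] ≠ 0` only in four
explicit congruence cases with `p ≤ 7`, after Kosters–Pannekoek), which the tree's division-polynomial
CERTIFICATE `natCard_localPTorsion_eq_one_of_certificate_zmod` cannot decide on these curves (`ψ_p(W)`
vanishes identically modulo `p^k` on the residue disc of the singular point — cell memo
MEMO-19601-kurihara-road-k8eta-c1-g6-v3 §A). PROOF (elementary; Serre, Invent. Math. 15 (1972) §1.11
for the valuations, Silverman *AEC* Ex. 3.7 for `ψ_p`):

> Let `Q = (x, y) ∈ W(ℚ_p)` with `p Q = O`. Over `L = \overline{ℚ_p}` pick `θ` with `θ² = d`; the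
> EXPLICIT change of variables `(θ⁻¹, 0, −a₁/2, −a₃/2)` carries `W` to `W^{(d)}` with abscissa
> `x ↦ d·x` (`twistVariableChange_smul`), and `C` carries `W^{(d)}` to `V` with `x ↦ u⁻²(x − r)`;
> so `V(L)` has a point of order `p` with abscissa `x'' = u⁻²(d x − r) ∈ ℚ_p`, and `x''` is a root of
> the `p`-division polynomial `ψ_p` of the minimal model of `V` (`zsmul_some_eq_zero_iff_eval_ΨSq`).
> But at a good supersingular `p` the integral polynomial `ψ_p = p X^d + c_{d−1} X^{d−1} + ⋯ + c_0`,
> `d = (p² − 1)/2 ≥ 4`, has `p ∣ c_i` for `i ≥ 1` and `p ∤ c_0` (tree: `dvd_coeff_preΨ'`,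
> `not_dvd_coeff_preΨ'_zero`, Serre §1.11), so it has NO root in `ℚ_p`
> (`eval_preΨ'_ne_zero_padic_of_supersingular`): for `|x| ≤ 1` the constant term is a unit and all
> other terms lie in `pℤ_p`; for `|x| ≥ p` the top term `p x^d` has norm `p^{−1}|x|^d > |c_i x^i|`
> for every `i < d` (its Newton polygon is the single segment of slope `2/(p² − 1) ∉ ℤ`).

CONSUMERS: the Kurihara-road records of `Summits/BirchSwinnertonDyer/BirchSwinnertonDyer/Theorems/
QuadraticBranchSignedControlPlusEta{R1KuriharaRows01,R0KuriharaKRows02–05,R1KuriharaLambdaRows06}.lean`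
(cell `bsd-potss`, K8 crux item stmt-BirchSwinnertonDyer-19601), whose displayed binder `ht0` this file
discharges (`natCard_localPTorsion_eq_one_of_quadraticBranch`, stated in their exact currency
`C • W.quadraticTwist ((-1) ^ (p / 2) * p) = V`, `V.HasGoodReductionAtPrime p`, `V.frobeniusTrace p = 0`).

## References
* C.-H. Kim, *The structure of Selmer groups and the Iwasawa main conjecture for elliptic curves*,
  Amer. J. Math. 148 (2026) = arXiv:2203.12159, §3.1 and Prop. 3.2 (PDF p. 15). [Kim2022StructureSelmer]
* J.-P. Serre, Invent. Math. 15 (1972) 259–331, §1.11 Prop. 12 (valuation of the `p`-torsion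
  abscissae at a supersingular prime). [Serre1972]
* J. H. Silverman, *The Arithmetic of Elliptic Curves*, 2nd ed., GTM 106 (2009), Exercise 3.7(d),(f),
  III.1 Table 3.1, X.2 Prop. 2.4 / X.5 Cor. 5.4 (twists). [SilvermanAEC2009]
* J. Neukirch, *Algebraic Number Theory*, Grundlehren 322 (1999), Ch. II §6, Prop. 6.3 (Newton polygon;
  background for §1, which is proved directly). [NeukirchANT1999]
-/

noncomputable section

open scoped Classical

open Polynomial WeierstrassCurve

namespace Literature.NumberTheory.EllipticCurves

/-! ### §1 An ultrametric Newton-polygon lemma over `ℚ_p` -/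

section NewtonPolygon

variable {p : ℕ} [hp : Fact p.Prime]

/-- `‖m‖_p ≤ p⁻¹` for an integer `m` divisible by `p`. [folklore] -/
private theorem norm_intCast_le_inv_of_dvd {m : ℤ} (h : (p : ℤ) ∣ m) :
    ‖(m : ℚ_[p])‖ ≤ (p : ℝ)⁻¹ := by
  obtain ⟨k, rfl⟩ := h
  push_cast
  rw [norm_mul, Padic.norm_p]
  exact mul_le_of_le_one_right (by positivity) (Padic.norm_int_le_one k)

/-- In a normed group, `a + b ≠ 0` as soon as `‖a‖ < ‖b‖`. [folklore] -/
private theorem add_ne_zero_of_norm_lt {K : Type*} [NormedAddCommGroup K] {a b : K}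
    (h : ‖a‖ < ‖b‖) : a + b ≠ 0 := by
  intro h0
  rw [add_eq_zero_iff_eq_neg] at h0
  rw [h0, norm_neg] at h
  exact lt_irrefl _ h

/-- **A Newton-polygon lemma over `ℚ_p`.** An integral polynomial `G = p X^d + c_{d-1} X^{d-1} + ⋯ + c_0`
of degree `d ≥ 2` with `p ∣ c_i` for all `i ≥ 1` and `p ∤ c_0` has no root in `ℚ_p`: for `|x| ≤ 1`
the constant term dominates, for `|x| ≥ p` the top term does (the Newton polygon of `G` is one segment
of slope `1/d ∉ ℤ`, so by the Newton-polygon theorem — Neukirch, *Algebraic Number Theory* II.6.3 — every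
root in `\overline{ℚ_p}` has valuation `−1/d ∉ v(ℚ_pˣ) = ℤ`; proved here directly by term domination).
[cite: NeukirchANT1999, Ch. II §6 Prop. 6.3 (Newton polygon)] -/
theorem eval_map_ne_zero_padic_of_coeff (G : ℤ[X]) {d : ℕ} (hd : 2 ≤ d) (hdeg : G.natDegree = d)
    (htop : G.coeff d = p) (hmid : ∀ i, i ≠ 0 → (p : ℤ) ∣ G.coeff i) (h0 : ¬ (p : ℤ) ∣ G.coeff 0)
    (x : ℚ_[p]) : (G.map (Int.castRingHom ℚ_[p])).eval x ≠ 0 := by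
  have hpp : p.Prime := hp.out
  have hp1 : (1 : ℝ) < p := by exact_mod_cast hpp.one_lt
  have hp0 : (0 : ℝ) < p := by positivity
  have hpinv : (p : ℝ)⁻¹ < 1 := inv_lt_one_of_one_lt₀ hp1
  set G' := G.map (Int.castRingHom ℚ_[p]) with hG'
  have hdeg' : G'.natDegree = d := by
    rw [hG', natDegree_map_eq_of_injective (Int.castRingHom ℚ_[p]).injective_int, hdeg]
  have hcoeff : ∀ i, G'.coeff i = ((G.coeff i : ℤ) : ℚ_[p]) := fun i ↦ by
    rw [hG', coeff_map, eq_intCast]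
  -- the constant coefficient is a unit, the others lie in `pℤ_p`
  have hc0 : ‖G'.coeff 0‖ = 1 := by
    rw [hcoeff]
    exact le_antisymm (Padic.norm_int_le_one _)
      (not_lt.mp fun h ↦ h0 (Padic.norm_intCast_lt_one_iff.mp h))
  have hci : ∀ i, i ≠ 0 → ‖G'.coeff i‖ ≤ (p : ℝ)⁻¹ := fun i hi ↦ by
    rw [hcoeff]; exact norm_intCast_le_inv_of_dvd (hmid i hi)
  have hcd : ‖G'.coeff d‖ = (p : ℝ)⁻¹ := by
    rw [hcoeff, htop, Int.cast_natCast, Padic.norm_p]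
  rw [eval_eq_sum_range, hdeg']
  rcases le_or_gt ‖x‖ 1 with hx | hx
  · -- `|x| ≤ 1`: `‖∑_{i ≥ 1} c_i x^i‖ ≤ p⁻¹ < 1 = ‖c_0‖`
    rw [Finset.sum_range_succ']
    refine add_ne_zero_of_norm_lt ?_
    rw [pow_zero, mul_one, hc0]
    refine lt_of_le_of_lt ?_ hpinv
    refine IsUltrametricDist.norm_sum_le_of_forall_le_of_nonneg (by positivity) fun i _ ↦ ?_
    rw [norm_mul, norm_pow]
    calc ‖G'.coeff (i + 1)‖ * ‖x‖ ^ (i + 1) ≤ (p : ℝ)⁻¹ * 1 := by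
          gcongr
          · exact hci _ (Nat.succ_ne_zero i)
          · exact pow_le_one₀ (norm_nonneg _) hx
      _ = (p : ℝ)⁻¹ := mul_one _
  · -- `|x| > 1`, hence `|x| ≥ p`: the top term dominates every other one
    have hx0 : x ≠ 0 := by
      rintro rfl; rw [norm_zero] at hx; exact not_lt.mpr zero_le_one hx
    have hxp : (p : ℝ) ≤ ‖x‖ := by
      rw [Padic.norm_eq_zpow_neg_valuation hx0] at hx ⊢
      have h1 : 0 < -x.valuation := (one_lt_zpow_iff_right₀ hp1).mp hx
      calc (p : ℝ) = (p : ℝ) ^ (1 : ℤ) := (zpow_one _).symm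
        _ ≤ (p : ℝ) ^ (-x.valuation) := zpow_le_zpow_right₀ hp1.le (by omega)
    have hx1 : (1 : ℝ) ≤ ‖x‖ := hx.le
    rw [Finset.sum_range_succ]
    have htopnorm : ‖G'.coeff d * x ^ d‖ = (p : ℝ)⁻¹ * ‖x‖ ^ d := by
      rw [norm_mul, norm_pow, hcd]
    -- `p⁻¹ |x|^d > 1`
    have hbig : (1 : ℝ) < (p : ℝ)⁻¹ * ‖x‖ ^ d := by
      have h2 : (p : ℝ) ^ 2 ≤ ‖x‖ ^ d :=
        (pow_le_pow_left₀ hp0.le hxp 2).trans (pow_le_pow_right₀ hx1 hd)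
      rw [lt_inv_mul_iff₀ hp0, mul_one]
      calc (p : ℝ) < (p : ℝ) ^ 2 := by
            rw [sq]; exact lt_mul_of_one_lt_right hp0 hp1
        _ ≤ ‖x‖ ^ d := h2
    have hdpos : 0 < d := by omega
    have hne : (Finset.range d).Nonempty := ⟨0, Finset.mem_range.mpr hdpos⟩
    obtain ⟨i, hi, hle⟩ := IsUltrametricDist.exists_norm_finsetSum_le_of_nonempty hne
      (fun i ↦ G'.coeff i * x ^ i)
    refine add_ne_zero_of_norm_lt (lt_of_le_of_lt hle ?_)
    rw [htopnorm, norm_mul, norm_pow]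
    rw [Finset.mem_range] at hi
    rcases Nat.eq_zero_or_pos i with rfl | hipos
    · rw [pow_zero, mul_one, hc0]; exact hbig
    · calc ‖G'.coeff i‖ * ‖x‖ ^ i ≤ (p : ℝ)⁻¹ * ‖x‖ ^ i := by
            gcongr; exact hci i (by omega)
        _ < (p : ℝ)⁻¹ * ‖x‖ ^ d := by
            exact mul_lt_mul_of_pos_left (pow_lt_pow_right₀ hx hi) (inv_pos.mpr hp0)

end NewtonPolygon

/-! ### §2 `ψ_p` of a good supersingular curve has no root in `ℚ_p` -/

section Supersingular

variable (p : ℕ) [hp : Fact p.Prime] {V : WeierstrassCurve ℚ} [V.IsElliptic] [V.IsGloballyMinimal]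

/-- **At a good supersingular odd prime `p`, the `p`-division polynomial `ψ_p` of the minimal model
has no root in `ℚ_p`** (`ψ_p = p X^d + ⋯ + c_0` with `d = (p² − 1)/2`, `p ∣ c_i` for `i ≥ 1`,
`p ∤ c_0` — the tree's `dvd_coeff_preΨ'`, `not_dvd_coeff_preΨ'_zero` — and §1). Serre 1972 §1.11:
the abscissae of the nonzero `p`-torsion points have valuation `−2/(p² − 1) ∉ ℤ`.
[cite: Serre1972, §1.11 Prop. 12] -/
theorem eval_preΨ'_ne_zero_padic_of_supersingular (hp2 : p ≠ 2)
    (hΔ : ¬ (p : ℤ) ∣ minimalDiscriminantInt V) (hss : (p : ℤ) ∣ V.frobeniusTrace p) (x : ℚ_[p]) :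
    (((integralModelInt V).preΨ' p).map (Int.castRingHom ℚ_[p])).eval x ≠ 0 := by
  have hpp : p.Prime := hp.out
  have hodd : ¬ Even p := fun h ↦ hp2 ((hpp.even_iff).mp h)
  have hp0 : ((p : ℕ) : ℤ) ≠ 0 := by exact_mod_cast hpp.ne_zero
  have hd := (integralModelInt V).natDegree_preΨ' (n := p) hp0
  have hc := (integralModelInt V).coeff_preΨ' p
  simp only [if_neg hodd] at hd hc
  have h3 : 3 ≤ p := by have := hpp.two_le; omega
  have hd2 : 2 ≤ (p ^ 2 - 1) / 2 := by
    have : 9 ≤ p ^ 2 := by nlinarith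
    omega
  exact eval_map_ne_zero_padic_of_coeff ((integralModelInt V).preΨ' p) hd2 hd hc
    (fun i hi ↦ dvd_coeff_preΨ' p hΔ hss hi) (not_dvd_coeff_preΨ'_zero p hΔ hss) x

end Supersingular

/-! ### §3 The explicit change of variables onto a quadratic twist by a square -/

section Twist

variable {F : Type*} [Field F] [NeZero (2 : F)] (W : WeierstrassCurve F)

/-- **Twisting by a square, explicitly**: for `θ ≠ 0` the change of variables
`(u, r, s, t) = (θ⁻¹, 0, −a₁/2, −a₃/2)` (complete the square, then rescale) carries `W` to its quadratic
twist `W^{(θ²)}`; on abscissae it is `x ↦ θ² x` (Silverman *AEC* III.1 Table 3.1 with X.2 Prop. 2.4 /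
X.5 Cor. 5.4; the tree's `exists_variableChange_smul_eq_quadraticTwist_sq` made explicit).
[cite: SilvermanAEC2009, III.1 Table 3.1 and X.5 Cor. 5.4] -/
theorem twistVariableChange_smul {θ : F} (hθ : θ ≠ 0) :
    (⟨(Units.mk0 θ hθ)⁻¹, 0, -W.a₁ / 2, -W.a₃ / 2⟩ : VariableChange F) • W =
      W.quadraticTwist (θ ^ 2) := by
  have h2 : (2 : F) ≠ 0 := two_ne_zero
  have h4 : (4 : F) ≠ 0 := by
    rw [show (4 : F) = 2 * 2 by norm_num]; exact mul_ne_zero h2 h2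
  ext
  · simp only [variableChange_a₁, quadraticTwist_a₁, inv_inv, Units.val_mk0]; field_simp; ring
  · simp only [variableChange_a₂, quadraticTwist_a₂, b₂, inv_inv, Units.val_mk0]
    field_simp; ring
  · simp only [variableChange_a₃, quadraticTwist_a₃, inv_inv, Units.val_mk0]; field_simp; ring
  · simp only [variableChange_a₄, quadraticTwist_a₄, b₄, inv_inv, Units.val_mk0]
    field_simp; ring
  · simp only [variableChange_a₆, quadraticTwist_a₆, b₆, inv_inv, Units.val_mk0]
    field_simp; ring

omit [NeZero (2 : F)] in
/-- Base change commutes with quadratic twisting (coefficientwise; private copy of the tree's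
`WeierstrassCurve.map_quadraticTwist` of `QuadraticTwistPadicReduction`, not imported here). [folklore] -/
private theorem map_quadraticTwist' {L : Type*} [Field L] (f : F →+* L) (d : F) :
    (W.quadraticTwist d).map f = (W.map f).quadraticTwist (f d) := by
  ext
  · simp
  · simp [map_div₀, map_ofNat]
  · simp
  · simp [map_div₀, map_ofNat]
  · simp [map_div₀, map_ofNat]

end Twist

/-! ### §4 `W(ℚ_p)[p] = 0` for the models of a quadratic twist of a good supersingular curve -/

section Main

variable (p : ℕ) [hp : Fact p.Prime] {V : WeierstrassCurve ℚ} [V.IsElliptic] [V.IsGloballyMinimal]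
  (W : WeierstrassCurve ℚ) (C : VariableChange ℚ) {d : ℚ}

/-- The transport step, over any field `L ⊇ ℚ_p` containing a square root `θ` of `d`: a point
`(x, y) ∈ W(ℚ_p)` killed by `p` would give the `ℚ_p`-rational root `u⁻²(d x − r)` of `ψ_p(V)`,
excluded by `eval_preΨ'_ne_zero_padic_of_supersingular`. [cite: Serre1972, §1.11 Prop. 12] -/
private theorem false_of_zsmul_some_eq_zero_aux {L : Type*} [Field L] [CharZero L] [Algebra ℚ L]
    [Algebra ℚ_[p] L] [IsScalarTower ℚ ℚ_[p] L] (hp2 : p ≠ 2)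
    (hΔ : ¬ (p : ℤ) ∣ minimalDiscriminantInt V) (hss : (p : ℤ) ∣ V.frobeniusTrace p)
    (hCV : C • W.quadraticTwist d = V) {θ : L} (hθ0 : θ ≠ 0) (hθ : θ ^ 2 = algebraMap ℚ L d)
    {x y : ℚ_[p]} (h : (W.baseChange ℚ_[p]).toAffine.Nonsingular x y)
    (hP : (p : ℤ) • (Affine.Point.some x y h : (W.baseChange ℚ_[p]).toAffine.Point) = 0) :
    False := by
  let ι : ℚ_[p] →ₐ[ℚ] L := IsScalarTower.toAlgHom ℚ ℚ_[p] L
  -- the point over `L`, then on `W^{(d)}`, then on `V`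
  let QL : (W.baseChange L).toAffine.Point := Affine.Point.map (W' := W.toAffine) ι (.some x y h)
  have hQL : (p : ℤ) • QL = 0 := by rw [← map_zsmul, hP, map_zero]
  let Cθ : VariableChange L :=
    ⟨(Units.mk0 θ hθ0)⁻¹, 0, -(W.baseChange L).a₁ / 2, -(W.baseChange L).a₃ / 2⟩
  let CL : VariableChange L := C.map (algebraMap ℚ L)
  have hcurve : CL • (Cθ • W.baseChange L) = V.baseChange L := by
    rw [twistVariableChange_smul (W.baseChange L) hθ0, hθ]
    change CL • (W.map (algebraMap ℚ L)).quadraticTwist _ = V.map (algebraMap ℚ L)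
    rw [← map_quadraticTwist', map_variableChange, hCV]
  let Q2 := VariableChange.pointEquiv (Cθ • W.baseChange L) CL
    (VariableChange.pointEquiv (W.baseChange L) Cθ QL)
  have hQ2 : (p : ℤ) • Q2 = 0 := by
    simp only [Q2, ← map_zsmul, hQL, map_zero]
  have hQ2' : Q2 = .some (CL.toX (Cθ.toX (ι x))) (CL.toY (Cθ.toX (ι x)) (Cθ.toY (ι x) (ι y)))
      ((VariableChange.nonsingular_iff _ CL _ _).mpr
        ((VariableChange.nonsingular_iff _ Cθ _ _).mpr
          ((W.toAffine.baseChange_nonsingular ι.injective x y).mpr h))) := rfl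
  -- the abscissa of the transported point is `ℚ_p`-rational
  let xF : ℚ_[p] := (algebraMap ℚ ℚ_[p] (C.u⁻¹ : ℚˣ)) ^ 2 *
    (algebraMap ℚ ℚ_[p] d * x - algebraMap ℚ ℚ_[p] C.r)
  have hxF : CL.toX (Cθ.toX (ι x)) = ι xF := by
    simp only [xF, VariableChange.toX_def, CL, Cθ, VariableChange.map, inv_inv, Units.val_mk0,
      sub_zero, Units.coe_map_inv, MonoidHom.coe_coe, map_mul, map_sub, map_pow, AlgHom.commutes,
      hθ]
  -- hence a `ℚ_p`-rational root of `ψ_p(V)`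
  have hpp : p.Prime := hp.out
  have hodd : ¬ Even p := fun h' ↦ hp2 ((hpp.even_iff).mp h')
  rw [hQ2'] at hQ2
  have hΨ := (zsmul_some_eq_zero_iff_eval_ΨSq _ _ (p : ℤ)).mp hQ2
  rw [hcurve, hxF] at hΨ
  have e : V.baseChange L = (integralModelInt V).map (Int.castRingHom L) := by
    conv_lhs => rw [← map_integralModelInt V]
    rw [baseChange, WeierstrassCurve.map_map]
    exact congrArg (integralModelInt V).map (RingHom.ext_int _ _)
  rw [e, ΨSq_ofNat, if_neg hodd, mul_one, map_preΨ', eval_pow] at hΨ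
  have hroot := (pow_eq_zero_iff two_ne_zero).mp hΨ
  have hι : Int.castRingHom L = (ι : ℚ_[p] →+* L).comp (Int.castRingHom ℚ_[p]) :=
    RingHom.ext_int _ _
  rw [hι, ← Polynomial.map_map, Polynomial.eval_map, ← AlgHom.coe_toRingHom, Polynomial.eval₂_hom,
    map_eq_zero] at hroot
  exact eval_preΨ'_ne_zero_padic_of_supersingular p hp2 hΔ hss xF hroot

/-- **`W(ℚ_p)[p] = 0` for every model `W/ℚ` of a quadratic twist of a globally minimal curve `V`
with good supersingular reduction at the odd prime `p`** (`C • W^{(d)} = V`, `d ≠ 0`, `p ∤ Δ_min(V)`,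
`p ∣ a_p(V)`): every `P ∈ W(ℚ_p)` with `p • P = O` is `O`. Kim 2026 Prop. 3.2 (additive case, `e = 2`,
`p ≥ 5`: never exceptional); proof in the module docstring (transport of the abscissa to a
`ℚ_p`-rational root of `ψ_p(V)` over `\overline{ℚ_p} ∋ √d`, excluded by
`eval_preΨ'_ne_zero_padic_of_supersingular`).
[cite: Kim2022StructureSelmer, Prop. 3.2 (PDF p. 15)] [cite: Serre1972, §1.11 Prop. 12] -/
theorem localTorsion_eq_zero_of_twist_of_supersingular (hp2 : p ≠ 2)
    (hΔ : ¬ (p : ℤ) ∣ minimalDiscriminantInt V) (hss : (p : ℤ) ∣ V.frobeniusTrace p)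
    (hd : d ≠ 0) (hCV : C • W.quadraticTwist d = V)
    (P : (W.baseChange ℚ_[p]).toAffine.Point) (hP : (p : ℤ) • P = 0) : P = 0 := by
  rcases P with _ | ⟨x, y, h⟩
  · rfl
  exfalso
  obtain ⟨θ, hθ⟩ : ∃ θ : AlgebraicClosure ℚ_[p], θ ^ 2 = algebraMap ℚ (AlgebraicClosure ℚ_[p]) d :=
    IsAlgClosed.exists_pow_nat_eq _ two_pos
  have hθ0 : θ ≠ 0 := by
    intro h0
    rw [h0, zero_pow two_ne_zero, eq_comm, map_eq_zero] at hθ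
    exact hd hθ
  exact false_of_zsmul_some_eq_zero_aux p W C hp2 hΔ hss hCV hθ0 hθ h hP

/-- **The `(t0)` binder discharged: `#W(ℚ_p)[p] = 1`** for every elliptic model `W/ℚ` of a
quadratic twist of a globally minimal curve `V` with good supersingular reduction at the odd prime
`p` (`C • W^{(d)} = V`, `d ≠ 0`, `p ∤ Δ_min(V)`, `p ∣ a_p(V)`) — the currency
`Nat.card {Q ∈ W(ℚ_p) // p • Q = O} = 1` of the tree's typed Kim facts
(`natCard_localPTorsion_eq_one_iff`). [cite: Kim2022StructureSelmer, Prop. 3.2 (PDF p. 15)] -/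
theorem natCard_localPTorsion_eq_one_of_twist_of_supersingular [W.IsElliptic] (hp2 : p ≠ 2)
    (hΔ : ¬ (p : ℤ) ∣ minimalDiscriminantInt V) (hss : (p : ℤ) ∣ V.frobeniusTrace p)
    (hd : d ≠ 0) (hCV : C • W.quadraticTwist d = V) :
    Nat.card {Q : (W.baseChange ℚ_[p]).toAffine.Point // (p : ℕ) • Q = 0} = 1 :=
  (natCard_localPTorsion_eq_one_iff W p).mpr
    (localTorsion_eq_zero_of_twist_of_supersingular p W C hp2 hΔ hss hd hCV)

/-- **The `(t0)` binder of the K8 Kurihara-road records, discharged** — in their exact currency: for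
`V/ℚ` globally minimal with `V.HasGoodReductionAtPrime p`, `V.frobeniusTrace p = 0`, `p` odd, and ANY
elliptic model `W/ℚ` with `C • W.quadraticTwist ((-1) ^ (p / 2) * p) = V` (the additive partner
`W = V ⊗ χ_{p*}`, Kodaira `I₀*` at `p`, potentially good supersingular over `ℚ_p(√p*)`, `e = 2`):
`Nat.card {Q ∈ W(ℚ_p) // p • Q = O} = 1`. (Cell `bsd-potss`, K8 crux item
stmt-BirchSwinnertonDyer-19601: the binder `ht0` of `…PlusEtaR1KuriharaRows01` & co.)
[cite: Kim2022StructureSelmer, Prop. 3.2 (PDF p. 15)] -/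
theorem natCard_localPTorsion_eq_one_of_quadraticBranch [W.IsElliptic] (hp2 : p ≠ 2)
    (hCV : C • W.quadraticTwist ((-1) ^ (p / 2) * p) = V) (hgood : V.HasGoodReductionAtPrime p)
    (hap : V.frobeniusTrace p = 0) :
    Nat.card {Q : (W.baseChange ℚ_[p]).toAffine.Point // (p : ℕ) • Q = 0} = 1 :=
  natCard_localPTorsion_eq_one_of_twist_of_supersingular p W C hp2
    (V.not_dvd_minimalDiscriminantInt_of_hasGoodReductionAtPrime' p hgood)
    (by rw [hap]; exact dvd_zero _) (mul_ne_zero (pow_ne_zero _ (by norm_num)) (by exact_mod_cast hp.out.ne_zero)) hCV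

/-- The same with the integer-scalar binder `∀ P ∈ W(ℚ_p), (p : ℤ) • P = O → P = O` (the `(t0)`
currency of `Kim2022_kuriharaNumber_certificate`). [cite: Kim2022StructureSelmer, Prop. 3.2 (PDF p. 15)] -/
theorem localTorsion_eq_zero_of_quadraticBranch (hp2 : p ≠ 2)
    (hCV : C • W.quadraticTwist ((-1) ^ (p / 2) * p) = V) (hgood : V.HasGoodReductionAtPrime p)
    (hap : V.frobeniusTrace p = 0) (P : (W.baseChange ℚ_[p]).toAffine.Point) (hP : (p : ℤ) • P = 0) :
    P = 0 :=
  localTorsion_eq_zero_of_twist_of_supersingular p W C hp2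
    (V.not_dvd_minimalDiscriminantInt_of_hasGoodReductionAtPrime' p hgood)
    (by rw [hap]; exact dvd_zero _) (mul_ne_zero (pow_ne_zero _ (by norm_num)) (by exact_mod_cast hp.out.ne_zero)) hCV
    P hP

end Main

end Literature.NumberTheory.EllipticCurves

end
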